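import Mathlib
import Literature.MathematicalPhysics.KineticTheory.FouriersLaw

/-!
# Density of smooth compactly supported functions in `L²(μ)` on phase space

For a finite Borel measure `μ` on the phase space `(Fin N → ℝ) × (Fin N → ℝ)` and `h ∈ L²(μ)`,
every `ε > 0` admits a `C_c^∞` function `φ` with `∫ (h - φ)² dμ ≤ ε`.  This is a direct
repackaging of Mathlib's `MeasureTheory.MemLp.exist_eLpNorm_sub_le` (density of `C_c^∞` in `Lp`
for `p < ∞` on a finite-dimensional space with a measure finite on compacts), converting the
bound `eLpNorm (h - φ) 2 μ ≤ √ε` into the integral form via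
`MeasureTheory.MemLp.eLpNorm_eq_integral_rpow_norm`.
-/

noncomputable section

open MeasureTheory
open scoped ENNReal NNReal
open Literature.MathematicalPhysics.KineticTheory.HeatConduction

namespace Summit.AtomisticToContinuum.FouriersLaw.Theorems.SubdiffusiveBondHeat

/-- Smooth compactly supported functions are dense in `L²(μ)` for a finite Borel measure `μ` on
phase space, in integral form: for `h ∈ L²(μ)` and `ε > 0` there is a `C_c^∞` function `φ` with
`∫ (h - φ)² dμ ≤ ε`. [folklore; Mathlib `MeasureTheory.MemLp.exist_eLpNorm_sub_le`] -/
theorem stub_smoothDenseL2 : ∀ (N : ℕ) (μ : Measure (PhaseSpace N)) [IsFiniteMeasure μ] (h : PhaseSpace N → ℝ), MemLp h 2 μ → ∀ ε : ℝ, 0 < ε → ∃ φ : PhaseSpace N → ℝ, ContDiff ℝ ((⊤ : ℕ∞) : WithTop ℕ∞) φ ∧ HasCompactSupport φ ∧ ∫ x, (h x - φ x) ^ 2 ∂μ ≤ ε := by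
  intro N μ _ h hh ε hε
  have hsq : 0 < Real.sqrt ε := Real.sqrt_pos.2 hε
  obtain ⟨g, hg_supp, hg_smooth, hg_norm⟩ :=
    hh.exist_eLpNorm_sub_le (p := 2) (by norm_num) (by norm_num) hsq
  refine ⟨g, hg_smooth, hg_supp, ?_⟩
  have hg_mem : MemLp g 2 μ := hg_smooth.continuous.memLp_of_hasCompactSupport hg_supp
  have hsub : MemLp (h - g) 2 μ := hh.sub hg_mem
  rw [hsub.eLpNorm_eq_integral_rpow_norm (by norm_num) (by norm_num),
    ENNReal.ofReal_le_ofReal_iff hsq.le] at hg_norm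
  have h2 : (2 : ℝ≥0∞).toReal = 2 := by norm_num
  rw [h2] at hg_norm
  have hnn : 0 ≤ ∫ a, ‖(h - g) a‖ ^ (2 : ℝ) ∂μ := integral_nonneg fun a => by positivity
  rw [Real.rpow_inv_le_iff_of_pos hnn hsq.le (by norm_num), Real.rpow_two,
    Real.sq_sqrt hε.le] at hg_norm
  have hI : ∫ x, (h x - g x) ^ 2 ∂μ = ∫ a, ‖(h - g) a‖ ^ (2 : ℝ) ∂μ := by
    refine integral_congr_ae (Filter.Eventually.of_forall fun a => ?_)
    simp only [Pi.sub_apply, Real.norm_eq_abs, Real.rpow_two, sq_abs]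
  rw [hI]
  exact hg_norm

end Summit.AtomisticToContinuum.FouriersLaw.Theorems.SubdiffusiveBondHeat

end
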